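import Mathlib
import HarnessLib
import Summits.ABC.ABC.Theses.CongruentialReceptacle
import Summits.ABC.ABC.Theorems.CompactBalanceTransfer.Negative.CuspWeightedResidueFree

/-!
# Line `Sketch` (card `cusp-weighted-receptacle`) — lead skeleton for crux stmt-ABC-1725
`Summit.ABC.ABC.Theses.CongruentialReceptacle.CompactBalanceTransfer`

Composition (one stub): `CompactBalanceTransfer_of := fun _H => abc_of_cuspWeightedReceptacle stub_CuspWeightedReceptacle`.

* `CuspWeightedReceptacle` — the stub's statement, VERBATIM the card's / `SketchIdeator1.lean`'s: the route's
  `TameLocalReceptacle` with the balance hypothesis `κ` deleted and the lower window `2(i+j+k) − 6 − ε ↦ k − 1 − ε`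
  (cusp weights: only the exponent of the SUM `c` is weighted).
* `stub_CuspWeightedReceptacle` — the ONLY `sorry` of the line.
* `abc_of_cuspWeightedReceptacle` — the glue `CuspWeightedReceptacle → ABC`, fully proved (so the stub is ≥ abc and
  the crux hypothesis is unused: the line is a DISSOLUTION of the archimedean partner, as its card says).
* `CompactBalanceTransfer_of` — concludes the crux by name.

Lead's verdict on the stub is recorded in `Lines/Sketch.dead.md` / NOTES (`## Census`): its residue-free strengthening
is refuted in Lean (`CuspWeightedResidueFree.lean`, three triples), the residue-dependent stub is the sibling crux
stmt-ABC-14354's open kill test and implies `ABC` by the theorem below.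
-/

set_option linter.dupNamespace false

namespace Summit.ABC.ABC.Cruxes.CompactBalanceTransfer.LineSketch

open Literature.NumberTheory.DiophantineGeometry
open Summit.ABC.ABC.Theses.CongruentialReceptacle

/-- THE STUB'S STATEMENT — cusp-weighted tame-local `ℤ/ℓⁿ` receptacle (card `cusp-weighted-receptacle`): for every
`ε > 0` constants `c₁ > 0, c₁′, c₃, m₀` such that for every prime power `ℓⁿ ≥ m₀` (`ℓ ≥ 5`) there is an INTEGER table
`t(p; v_p a, v_p b, v_p c; a′, b′, c′ mod p)` with lower window `c₁ (v_p c − 1 − ε) log p ≤ t`, upper window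
`|t| ≤ c₁′ (v_p a + v_p b + v_p c + 1) log p`, whose sum over `p ∣ abc` is `≡ B (mod ℓⁿ)` with `|B| ≤ c₃` on every
abc-triple prime to `ℓ`. Verbatim `SketchIdeator1.CuspWeightedReceptacle`. -/
def CuspWeightedReceptacle : Prop :=
  ∀ ε : ℝ, 0 < ε → ∃ c₁ c₁' c₃ : ℝ, 0 < c₁ ∧ ∃ m₀ : ℕ, ∀ ℓ n : ℕ, ℓ.Prime → 5 ≤ ℓ → m₀ ≤ ℓ ^ n →
    ∃ t : ℕ → ℕ → ℕ → ℕ → ℕ → ℕ → ℕ → ℤ,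
      (∀ p i j k r s z : ℕ, p.Prime →
        c₁ * (((k : ℕ) : ℝ) - 1 - ε) * Real.log p ≤ (t p i j k r s z : ℝ) ∧
        |(t p i j k r s z : ℝ)| ≤ c₁' * (((i + j + k : ℕ) : ℝ) + 1) * Real.log p) ∧
      ∀ a b c : ℕ, IsABCTriple a b c → ¬ ℓ ∣ a * b * c →
        ∃ B : ℤ, |(B : ℝ)| ≤ c₃ ∧
          (∑ p ∈ (a * b * c).primeFactors,
              t p (a.factorization p) (b.factorization p) (c.factorization p)
                (a / p ^ a.factorization p % p) (b / p ^ b.factorization p % p)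
                (c / p ^ c.factorization p % p)) ≡ B [ZMOD ((ℓ ^ n : ℕ) : ℤ)]

/-- STUB (the line's only open obligation; hardest and sole stub — ≥ abc-strength, see
`abc_of_cuspWeightedReceptacle`). -/
theorem stub_CuspWeightedReceptacle : CuspWeightedReceptacle := by
  sorry

/-- Congruence to equality (as in the landed glue file). -/
theorem congruenceToEquality' {m x y : ℤ} (h : x ≡ y [ZMOD m])
    (hx : 2 * |x| < m) (hy : 2 * |y| < m) : x = y := by
  have hd : m ∣ x - y := h.symm.dvd
  have habs : |x - y| < m := by
    rw [abs_lt]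
    constructor
    · linarith [le_abs_self x, neg_abs_le x, le_abs_self y, neg_abs_le y]
    · linarith [le_abs_self x, neg_abs_le x, le_abs_self y, neg_abs_le y]
  have h0 := Int.eq_zero_of_abs_lt_dvd hd habs
  linarith

/-- STRENGTH OF THE STUB (glue, proved; copied from `SketchIdeator1.cuspWeightedGlue_holds`): the stub alone gives
`ABC` — read the congruence at a prime `ℓ > abc + 4` and `ℓⁿ > 2·max(Z, c₃)`, where it is an identity in `ℤ`
(congruence-to-equality), and sum the lower window: `c₁ (log c − (1+ε) log rad(abc)) ≤ c₃`. Hence the stub is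
≥ abc-strength and the crux hypothesis `H` (balanced abc for every `κ`) is NOT used by this line. -/
theorem abc_of_cuspWeightedReceptacle (hR : CuspWeightedReceptacle) : _root_.ABC := by
  refine (ABC_iff).mpr ?_
  intro ε hε
  obtain ⟨c₁, c₁', c₃, hc₁, m₀, H⟩ := hR ε hε
  refine ⟨Real.exp (c₃ / c₁) + 1, by positivity, ?_⟩
  intro a b c habc
  have ha0 : a ≠ 0 := Nat.pos_iff_ne_zero.mp habc.1
  have hb0 : b ≠ 0 := Nat.pos_iff_ne_zero.mp habc.2.1
  have hc0 : c ≠ 0 := by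
    have := habc.2.2.1
    omega
  set N : ℕ := a * b * c with hN
  have hN0 : N ≠ 0 := mul_ne_zero (mul_ne_zero ha0 hb0) hc0
  have hcpos : (0 : ℝ) < (c : ℝ) := by exact_mod_cast Nat.pos_of_ne_zero hc0
  have hRpos : (0 : ℝ) < ((rad a b c : ℕ) : ℝ) := by
    have h0 : 0 < rad a b c := by
      rw [rad_def]
      exact Nat.pos_of_ne_zero UniqueFactorizationMonoid.radical_ne_zero
    exact_mod_cast h0
  -- Σ_{p ∣ N} v_p(c) log p = log c  (the product formula for c, summed over the larger support of N)
  have hsub : c.primeFactors ⊆ N.primeFactors :=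
    Nat.primeFactors_mono (dvd_mul_left c (a * b)) hN0
  have hlogC : ∑ p ∈ N.primeFactors, ((c.factorization p : ℕ) : ℝ) * Real.log p = Real.log c := by
    rw [Real.log_nat_eq_sum_factorization, Finsupp.sum, Nat.support_factorization]
    symm
    refine Finset.sum_subset hsub ?_
    intro p hpN hpc
    have pp := Nat.prime_of_mem_primeFactors hpN
    have hndvd : ¬ p ∣ c := fun h => hpc (Nat.mem_primeFactors.mpr ⟨pp, h, hc0⟩)
    simp [Nat.factorization_eq_zero_of_not_dvd hndvd]
  have hlogR : ∑ p ∈ N.primeFactors, Real.log p = Real.log ((rad a b c : ℕ) : ℝ) := by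
    rw [rad_def, ← hN, Nat.radical_eq_prod_primeFactors, Nat.cast_prod, Real.log_prod]
    intro p hp
    exact_mod_cast (Nat.prime_of_mem_primeFactors hp).ne_zero
  -- the uniform a-priori bound Z on |Σ_p t(p; D_p)|
  set Z : ℝ := ∑ p ∈ N.primeFactors,
    c₁' * (((a.factorization p + b.factorization p + c.factorization p : ℕ) : ℝ) + 1) * Real.log p
    with hZ
  -- the modulus: a prime ℓ ≥ N + 5 and an exponent n with ℓ ^ n above everything
  obtain ⟨ℓ, hℓge, hℓp⟩ := Nat.exists_infinite_primes (N + 5)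
  have h5 : 5 ≤ ℓ := by omega
  have hℓN : ¬ ℓ ∣ N := by
    intro h
    have := Nat.le_of_dvd (Nat.pos_of_ne_zero hN0) h
    omega
  set n : ℕ := m₀ + ⌈2 * Z⌉₊ + ⌈2 * c₃⌉₊ + 1 with hn
  have hnlt : n < ℓ ^ n := Nat.lt_pow_self (by omega)
  have hm₀ : m₀ ≤ ℓ ^ n := by omega
  have hnR : 2 * Z < (n : ℝ) ∧ 2 * c₃ < (n : ℝ) := by
    rw [hn]
    push_cast
    constructor
    · linarith [Nat.le_ceil (2 * Z), Nat.le_ceil (2 * c₃), (Nat.cast_nonneg m₀ : (0 : ℝ) ≤ m₀),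
        (Nat.cast_nonneg ⌈2 * c₃⌉₊ : (0 : ℝ) ≤ ⌈2 * c₃⌉₊)]
    · linarith [Nat.le_ceil (2 * Z), Nat.le_ceil (2 * c₃), (Nat.cast_nonneg m₀ : (0 : ℝ) ≤ m₀),
        (Nat.cast_nonneg ⌈2 * Z⌉₊ : (0 : ℝ) ≤ ⌈2 * Z⌉₊)]
  have hpowR : (n : ℝ) < ((ℓ ^ n : ℕ) : ℝ) := by exact_mod_cast hnlt
  -- the table at modulus ℓ ^ n and the congruence for our triple
  obtain ⟨t, ht, hB⟩ := H ℓ n hℓp h5 hm₀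
  obtain ⟨B, hBle, hcong⟩ := hB a b c habc hℓN
  set S : ℤ := ∑ p ∈ N.primeFactors, t p (a.factorization p) (b.factorization p) (c.factorization p)
    (a / p ^ a.factorization p % p) (b / p ^ b.factorization p % p) (c / p ^ c.factorization p % p)
    with hS
  -- upper window: |S| ≤ Z
  have hSabs : |(S : ℝ)| ≤ Z := by
    rw [hS, Int.cast_sum, hZ]
    refine (Finset.abs_sum_le_sum_abs _ _).trans ?_
    exact Finset.sum_le_sum fun p hp => (ht p _ _ _ _ _ _ (Nat.prime_of_mem_primeFactors hp)).2
  -- lower window: c₁ (log c - (1 + ε) log rad) ≤ S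
  have hSlow : ∑ p ∈ N.primeFactors,
      c₁ * (((c.factorization p : ℕ) : ℝ) - 1 - ε) * Real.log p ≤ (S : ℝ) := by
    rw [hS, Int.cast_sum]
    exact Finset.sum_le_sum fun p hp => (ht p _ _ _ _ _ _ (Nat.prime_of_mem_primeFactors hp)).1
  have hlow_eq : ∑ p ∈ N.primeFactors, c₁ * (((c.factorization p : ℕ) : ℝ) - 1 - ε) * Real.log p
      = c₁ * (Real.log c - (1 + ε) * Real.log ((rad a b c : ℕ) : ℝ)) := by
    rw [← hlogC, ← hlogR, Finset.mul_sum, ← Finset.sum_sub_distrib, Finset.mul_sum]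
    refine Finset.sum_congr rfl fun p _ => ?_
    ring
  -- congruence to equality: S = B, hence S ≤ c₃
  have hSlt : 2 * |S| < ((ℓ ^ n : ℕ) : ℤ) := by
    have h : 2 * |(S : ℝ)| < ((ℓ ^ n : ℕ) : ℝ) := by linarith [hnR.1]
    exact_mod_cast h
  have hBlt : 2 * |B| < ((ℓ ^ n : ℕ) : ℤ) := by
    have h : 2 * |(B : ℝ)| < ((ℓ ^ n : ℕ) : ℝ) := by linarith [hnR.2]
    exact_mod_cast h
  have hSB : S = B := congruenceToEquality' hcong hSlt hBlt
  have hSle : (S : ℝ) ≤ c₃ := by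
    rw [hSB]
    exact (le_abs_self _).trans hBle
  -- the height inequality log c ≤ (1 + ε) log rad + c₃ / c₁
  have hkey : c₁ * (Real.log c - (1 + ε) * Real.log ((rad a b c : ℕ) : ℝ)) ≤ c₃ := by
    rw [← hlow_eq]
    exact hSlow.trans hSle
  have hkey' : Real.log c ≤ (1 + ε) * Real.log ((rad a b c : ℕ) : ℝ) + c₃ / c₁ := by
    have h : Real.log c - (1 + ε) * Real.log ((rad a b c : ℕ) : ℝ) ≤ c₃ / c₁ := by
      rw [le_div_iff₀ hc₁]
      linarith
    linarith
  -- exponentiate: c ≤ exp(c₃/c₁) · rad^(1+ε) < (exp(c₃/c₁) + 1) · rad^(1+ε)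
  have hcle : (c : ℝ) ≤ Real.exp (c₃ / c₁) * ((rad a b c : ℕ) : ℝ) ^ (1 + ε) := by
    rw [Real.rpow_def_of_pos hRpos, ← Real.exp_add]
    calc (c : ℝ) = Real.exp (Real.log c) := (Real.exp_log hcpos).symm
      _ ≤ Real.exp (c₃ / c₁ + Real.log ((rad a b c : ℕ) : ℝ) * (1 + ε)) :=
          Real.exp_le_exp.mpr (by linarith)
  have hSpos : (0 : ℝ) < ((rad a b c : ℕ) : ℝ) ^ (1 + ε) := Real.rpow_pos_of_pos hRpos _
  calc (c : ℝ) ≤ Real.exp (c₃ / c₁) * ((rad a b c : ℕ) : ℝ) ^ (1 + ε) := hcle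
    _ < (Real.exp (c₃ / c₁) + 1) * ((rad a b c : ℕ) : ℝ) ^ (1 + ε) := by nlinarith [hSpos]


/-- The RESIDUE-FREE strengthening of the stub: the same receptacle for tables `t(p; v_p a, v_p b, v_p c)` that ignore the
unit residues. Logical position: `RF → stub` (`cuspWeightedReceptacle_of_residueFree`) and `¬ RF`
(`residueFree_refuted`, = the landed `Theorems/CompactBalanceTransfer/Negative/CuspWeightedResidueFree.lean`), so every
witness of the stub must use the residues. -/
def CuspWeightedReceptacleResidueFree : Prop :=
  ∀ ε : ℝ, 0 < ε → ∃ c₁ c₁' c₃ : ℝ, 0 < c₁ ∧ ∃ m₀ : ℕ, ∀ ℓ n : ℕ, ℓ.Prime → 5 ≤ ℓ → m₀ ≤ ℓ ^ n →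
    ∃ t : ℕ → ℕ → ℕ → ℕ → ℤ,
      (∀ p i j k : ℕ, p.Prime →
        c₁ * (((k : ℕ) : ℝ) - 1 - ε) * Real.log p ≤ (t p i j k : ℝ) ∧
        |(t p i j k : ℝ)| ≤ c₁' * (((i + j + k : ℕ) : ℝ) + 1) * Real.log p) ∧
      ∀ a b c : ℕ, IsABCTriple a b c → ¬ ℓ ∣ a * b * c →
        ∃ B : ℤ, |(B : ℝ)| ≤ c₃ ∧
          (∑ p ∈ (a * b * c).primeFactors,
              t p (a.factorization p) (b.factorization p) (c.factorization p)) ≡ B [ZMOD ((ℓ ^ n : ℕ) : ℤ)]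

/-- `RF → stub`: a residue-free table is a table (extend it constantly in the residue arguments). -/
theorem cuspWeightedReceptacle_of_residueFree (h : CuspWeightedReceptacleResidueFree) : CuspWeightedReceptacle := by
  intro ε hε
  obtain ⟨c₁, c₁', c₃, hc₁, m₀, H⟩ := h ε hε
  refine ⟨c₁, c₁', c₃, hc₁, m₀, fun ℓ n hℓ h5 hm => ?_⟩
  obtain ⟨t, ht, hT⟩ := H ℓ n hℓ h5 hm
  exact ⟨fun p i j k _ _ _ => t p i j k, fun p i j k _ _ _ hp => ht p i j k hp, hT⟩

/-- `¬ RF` — the residue-free strengthening is FALSE (landed negative lemma, three-triple certificate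
`(1,2ᵏ−1,2ᵏ), (2,2ᵏ−1,2ᵏ+1), (1,2ᵏ,2ᵏ+1)` at one prime modulus). -/
theorem residueFree_refuted : ¬ CuspWeightedReceptacleResidueFree :=
  Summit.ABC.ABC.Theorems.CompactBalanceTransfer.Negative.not_cuspWeightedReceptacle_residueFree

/-- COMPOSITION: the crux `CompactBalanceTransfer` (= `H → ABC`) from the single stub; the hypothesis `H` is
discarded (`fun _ => …`) — the line dissolves the archimedean partner instead of transferring it. -/
theorem CompactBalanceTransfer_of : CompactBalanceTransfer :=
  fun _ => abc_of_cuspWeightedReceptacle stub_CuspWeightedReceptacle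

end Summit.ABC.ABC.Cruxes.CompactBalanceTransfer.LineSketch
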